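import Mathlib
import HarnessLib
import Literature.Analysis.FluidPDE.TypeIAncientMild
import Literature.Analysis.FluidPDE.TaoEnstrophyLocalisation
import Summits.NavierStokesRegularity.NavierStokesRegularity.Theorems.SqueezeCycleExtremalElementExistsExtraction
import Summits.NavierStokesRegularity.NavierStokesRegularity.Theorems.SqueezeCycleExtremalBiaxialitySubcriticalSmallConstant
import Summits.NavierStokesRegularity.NavierStokesRegularity.Theorems.SymmetryModuliCountFarPastLedgerReduction

/-!
# Route `PoloidalWindowDoor`, crux `PoloidalWindowRigidity` (K2, stmt-NavierStokesRegularity-19708) —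
# an EXTREMAL ELEMENT of the POLOIDAL sub-class (normal form for the residue S2′)

Cell ns-regularity-ideate, K2 lead ns-poloidal-K2-p1 (support file, `--supports stmt-…-19708 --as helper`; task (H1) of
the lead's PICKED.md).  The residue S2′ is a Liouville statement about the sub-class 𝔓_pol(C) of the KNSS Type-I ancient mild
class 𝔓(C) (`IsTypeIAncientMild C`) cut out by «poloidal along e₂» (`⟪curl v(s) y, e₂⟫ = 0`) and the frozen constraint
(`⟪Dv(s)(y) curl v(s)(y), e₂⟫ = 0`).  This file moves ONE piece of free global structure into the hands of the residue
prover: the sub-class is closed under the symmetries of 𝔓 (translations, parabolic rescalings) and under the KNSS limits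
(`exists_tendsto_of_isTypeIAncientMild_seq` converges fields AND gradients), so the extremal-constant argument of route
`ExtremalTypeIConstant` (`extremalTypeIConstant_minimiserExists_proof`, KNSS 2009 §6) runs INSIDE it:

* `tendsto_curl_of_tendsto_fderiv`, `poloidal_of_tendsto`, `frozen_of_tendsto` — closedness under gradient convergence;
* `poloidal_translate`, `frozen_translate`, `poloidal_nsRescale`, `frozen_nsRescale` — invariance under the symmetries;
* `exists_poloidal_extremal` — **if some poloidal frozen element of some 𝔓(C) is nontrivial, then there are `C⋆ > 0` and
  a poloidal frozen `W ∈ 𝔓(C⋆)` with `‖W(−1,0)‖ = C⋆`, `C⋆` minimal among the constants of nontrivial poloidal frozen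
  elements.**  So the residue prover may assume WLOG that the profile ATTAINS its (sub-class-sharp) Type-I constant at
  the hot spot `(−1, 0)`: `(−t)‖W(t,x)‖² ≤ C⋆² = ‖W(−1,0)‖²` on the slab.

WHAT THIS IS NOT: not a claim about Navier–Stokes regularity and not the residue — a normal form (compactness + symmetry,
no new mechanism), bears_on LADDER-NS N0, rung N0-LocalTubeDoorPoloidal.
-/

noncomputable section

-- the summit and its single sub-problem share the name (CONVENTIONS §1), as in every Theorems file
set_option linter.dupNamespace false

namespace Summit.NavierStokesRegularity.NavierStokesRegularity.Theorems.PoloidalWindowDoorPoloidalWindowRigidityPoloidalExtremal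

open MeasureTheory Set Function Filter Topology
open scoped RealInnerProductSpace InnerProductSpace
open Literature.Analysis Literature.Analysis.FluidPDE
open Summit.NavierStokesRegularity.NavierStokesRegularity.Theorems

/-! ### Closedness of «poloidal + frozen» under convergence of gradients -/

/-- Convergence of gradients gives convergence of vorticities (`curl V y = curlCLM (DV(y))`). -/
theorem tendsto_curl_of_tendsto_fderiv {V : ℕ → EuclideanSpace ℝ (Fin 3) → EuclideanSpace ℝ (Fin 3)}
    {W : EuclideanSpace ℝ (Fin 3) → EuclideanSpace ℝ (Fin 3)} {y : EuclideanSpace ℝ (Fin 3)}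
    (h : Tendsto (fun j => fderiv ℝ (V j) y) atTop (𝓝 (fderiv ℝ W y))) :
    Tendsto (fun j => curl (V j) y) atTop (𝓝 (curl W y)) := by
  have e : (fun j => curl (V j) y) = fun j => curlCLM (fderiv ℝ (V j) y) := funext fun j => curl_eq_curlCLM _ _
  rw [e, curl_eq_curlCLM]
  exact (curlCLM.continuous.tendsto _).comp h

/-- «Poloidal along `e₂`» passes to limits of gradients. -/
theorem poloidal_of_tendsto {V : ℕ → EuclideanSpace ℝ (Fin 3) → EuclideanSpace ℝ (Fin 3)}
    {W : EuclideanSpace ℝ (Fin 3) → EuclideanSpace ℝ (Fin 3)} {y : EuclideanSpace ℝ (Fin 3)}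
    (h : Tendsto (fun j => fderiv ℝ (V j) y) atTop (𝓝 (fderiv ℝ W y)))
    (hpol : ∀ j, ⟪curl (V j) y, EuclideanSpace.single 2 (1 : ℝ)⟫_ℝ = 0) :
    ⟪curl W y, EuclideanSpace.single 2 (1 : ℝ)⟫_ℝ = 0 := by
  have ht : Tendsto (fun j => ⟪curl (V j) y, EuclideanSpace.single 2 (1 : ℝ)⟫_ℝ) atTop
      (𝓝 ⟪curl W y, EuclideanSpace.single 2 (1 : ℝ)⟫_ℝ) :=
    (tendsto_curl_of_tendsto_fderiv h).inner tendsto_const_nhds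
  have h0 : Tendsto (fun j => ⟪curl (V j) y, EuclideanSpace.single 2 (1 : ℝ)⟫_ℝ) atTop (𝓝 0) := by
    simp only [hpol]; exact tendsto_const_nhds
  exact tendsto_nhds_unique ht h0

/-- The frozen constraint `⟪DV(y) curl V(y), e₂⟫ = 0` passes to limits of gradients. -/
theorem frozen_of_tendsto {V : ℕ → EuclideanSpace ℝ (Fin 3) → EuclideanSpace ℝ (Fin 3)}
    {W : EuclideanSpace ℝ (Fin 3) → EuclideanSpace ℝ (Fin 3)} {y : EuclideanSpace ℝ (Fin 3)}
    (h : Tendsto (fun j => fderiv ℝ (V j) y) atTop (𝓝 (fderiv ℝ W y)))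
    (hfro : ∀ j, ⟪fderiv ℝ (V j) y (curl (V j) y), EuclideanSpace.single 2 (1 : ℝ)⟫_ℝ = 0) :
    ⟪fderiv ℝ W y (curl W y), EuclideanSpace.single 2 (1 : ℝ)⟫_ℝ = 0 := by
  have happ : Tendsto (fun j => fderiv ℝ (V j) y (curl (V j) y)) atTop (𝓝 (fderiv ℝ W y (curl W y))) := by
    have hc := tendsto_curl_of_tendsto_fderiv h
    -- joint continuity of the evaluation `(A, w) ↦ A w` on bounded operators
    exact ((isBoundedBilinearMap_apply (𝕜 := ℝ) (E := EuclideanSpace ℝ (Fin 3))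
      (F := EuclideanSpace ℝ (Fin 3))).continuous.tendsto (fderiv ℝ W y, curl W y)).comp (h.prodMk_nhds hc)
  have ht : Tendsto (fun j => ⟪fderiv ℝ (V j) y (curl (V j) y), EuclideanSpace.single 2 (1 : ℝ)⟫_ℝ) atTop
      (𝓝 ⟪fderiv ℝ W y (curl W y), EuclideanSpace.single 2 (1 : ℝ)⟫_ℝ) := happ.inner tendsto_const_nhds
  have h0 : Tendsto (fun j => ⟪fderiv ℝ (V j) y (curl (V j) y), EuclideanSpace.single 2 (1 : ℝ)⟫_ℝ) atTop (𝓝 0) := by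
    simp only [hfro]; exact tendsto_const_nhds
  exact tendsto_nhds_unique ht h0

/-! ### Invariance under the symmetries of the class -/

/-- Gradient of a translate. -/
theorem fderiv_translate (V : EuclideanSpace ℝ (Fin 3) → EuclideanSpace ℝ (Fin 3)) (x₀ y : EuclideanSpace ℝ (Fin 3)) :
    fderiv ℝ (fun x => V (x₀ + x)) y = fderiv ℝ V (x₀ + y) := by
  rw [fderiv_comp_add_left]

/-- Vorticity of a translate. -/
theorem curl_translate (V : EuclideanSpace ℝ (Fin 3) → EuclideanSpace ℝ (Fin 3)) (x₀ y : EuclideanSpace ℝ (Fin 3)) :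
    curl (fun x => V (x₀ + x)) y = curl V (x₀ + y) := by
  rw [curl_eq_curlCLM, curl_eq_curlCLM, fderiv_translate]

/-- Gradient of a parabolic rescaling: `D(nsRescale c u s)(y) = c² • Du(c²s)(c y)` (no differentiability needed). -/
theorem fderiv_nsRescale_slice (c : ℝ) (u : ℝ → EuclideanSpace ℝ (Fin 3) → EuclideanSpace ℝ (Fin 3)) (s : ℝ)
    (y : EuclideanSpace ℝ (Fin 3)) :
    fderiv ℝ (nsRescale c u s) y = c ^ 2 • fderiv ℝ (u (c ^ 2 * s)) (c • y) := by
  have e : nsRescale c u s = c • (fun x => u (c ^ 2 * s) (c • x)) := by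
    funext x; rw [nsRescale_apply]; rfl
  rw [e, fderiv_const_smul_field, Pi.smul_apply, fderiv_comp_smul, smul_smul, pow_two]

/-- Vorticity of a parabolic rescaling: `curl (nsRescale c u s) y = c² • curl (u (c² s)) (c y)`. -/
theorem curl_nsRescale_slice (c : ℝ) (u : ℝ → EuclideanSpace ℝ (Fin 3) → EuclideanSpace ℝ (Fin 3)) (s : ℝ)
    (y : EuclideanSpace ℝ (Fin 3)) :
    curl (nsRescale c u s) y = c ^ 2 • curl (u (c ^ 2 * s)) (c • y) := by
  rw [curl_eq_curlCLM, curl_eq_curlCLM, fderiv_nsRescale_slice, map_smul]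

/-- Poloidality is preserved by translation. -/
theorem poloidal_translate {u : ℝ → EuclideanSpace ℝ (Fin 3) → EuclideanSpace ℝ (Fin 3)}
    (hpol : ∀ s < 0, ∀ y, ⟪curl (u s) y, EuclideanSpace.single 2 (1 : ℝ)⟫_ℝ = 0) (x₀ : EuclideanSpace ℝ (Fin 3)) :
    ∀ s < 0, ∀ y, ⟪curl ((fun t x => u t (x₀ + x)) s) y, EuclideanSpace.single 2 (1 : ℝ)⟫_ℝ = 0 := by
  intro s hs y
  rw [show (fun t x => u t (x₀ + x)) s = fun x => u s (x₀ + x) from rfl, curl_translate]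
  exact hpol s hs _

/-- The frozen constraint is preserved by translation. -/
theorem frozen_translate {u : ℝ → EuclideanSpace ℝ (Fin 3) → EuclideanSpace ℝ (Fin 3)}
    (hfro : ∀ s < 0, ∀ y, ⟪fderiv ℝ (u s) y (curl (u s) y), EuclideanSpace.single 2 (1 : ℝ)⟫_ℝ = 0)
    (x₀ : EuclideanSpace ℝ (Fin 3)) :
    ∀ s < 0, ∀ y, ⟪fderiv ℝ ((fun t x => u t (x₀ + x)) s) y (curl ((fun t x => u t (x₀ + x)) s) y),
      EuclideanSpace.single 2 (1 : ℝ)⟫_ℝ = 0 := by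
  intro s hs y
  rw [show (fun t x => u t (x₀ + x)) s = fun x => u s (x₀ + x) from rfl, curl_translate, fderiv_translate]
  exact hfro s hs _

/-- Poloidality is preserved by parabolic rescaling with `c > 0`. -/
theorem poloidal_nsRescale {u : ℝ → EuclideanSpace ℝ (Fin 3) → EuclideanSpace ℝ (Fin 3)}
    (hpol : ∀ s < 0, ∀ y, ⟪curl (u s) y, EuclideanSpace.single 2 (1 : ℝ)⟫_ℝ = 0) {c : ℝ} (hc : 0 < c) :
    ∀ s < 0, ∀ y, ⟪curl (nsRescale c u s) y, EuclideanSpace.single 2 (1 : ℝ)⟫_ℝ = 0 := by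
  intro s hs y
  rw [curl_nsRescale_slice, inner_smul_left, hpol _ (mul_neg_of_pos_of_neg (pow_pos hc 2) hs), mul_zero]

/-- The frozen constraint is preserved by parabolic rescaling with `c > 0`. -/
theorem frozen_nsRescale {u : ℝ → EuclideanSpace ℝ (Fin 3) → EuclideanSpace ℝ (Fin 3)}
    (hfro : ∀ s < 0, ∀ y, ⟪fderiv ℝ (u s) y (curl (u s) y), EuclideanSpace.single 2 (1 : ℝ)⟫_ℝ = 0)
    {c : ℝ} (hc : 0 < c) :
    ∀ s < 0, ∀ y, ⟪fderiv ℝ (nsRescale c u s) y (curl (nsRescale c u s) y), EuclideanSpace.single 2 (1 : ℝ)⟫_ℝ = 0 := by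
  intro s hs y
  rw [curl_nsRescale_slice, fderiv_nsRescale_slice]
  simp only [_root_.smul_apply, map_smul, smul_smul, inner_smul_left,
    hfro _ (mul_neg_of_pos_of_neg (pow_pos hc 2) hs), mul_zero]

/-! ### The extremal element of the poloidal sub-class -/

/-- **An extremal poloidal profile exists.**  If some poloidal, frozen element of some KNSS Type-I class `𝔓(C)` is
nontrivial, then the least Type-I constant `C⋆` carried by a nontrivial poloidal frozen element is positive and
ATTAINED: there is a poloidal frozen `W ∈ 𝔓(C⋆)` with `‖W(−1, 0)‖ = C⋆`, and `C⋆ ≤ C'` whenever `𝔓(C')` contains a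
nontrivial poloidal frozen element (gap `exists_typeIAncientMild_eq_zero_of_small`; minimising sequence renormalised
by translation and parabolic scaling to the hot spot `(−1,0)`; KNSS compactness with convergence of GRADIENTS
`exists_tendsto_of_isTypeIAncientMild_seq`; closedness `poloidal_of_tendsto` / `frozen_of_tendsto`).  In particular
`(−t)‖W(t,x)‖² ≤ ‖W(−1,0)‖²` on the slab: the residue prover may work at a hot spot. -/
theorem exists_poloidal_extremal
    (hex : ∃ (C : ℝ) (u : ℝ → EuclideanSpace ℝ (Fin 3) → EuclideanSpace ℝ (Fin 3)), IsTypeIAncientMild C u ∧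
      (∀ s < 0, ∀ y, ⟪curl (u s) y, EuclideanSpace.single 2 (1 : ℝ)⟫_ℝ = 0) ∧
      (∀ s < 0, ∀ y, ⟪fderiv ℝ (u s) y (curl (u s) y), EuclideanSpace.single 2 (1 : ℝ)⟫_ℝ = 0) ∧
      ∃ t < 0, ∃ x, u t x ≠ 0) :
    ∃ (Cs : ℝ) (W : ℝ → EuclideanSpace ℝ (Fin 3) → EuclideanSpace ℝ (Fin 3)), 0 < Cs ∧ IsTypeIAncientMild Cs W ∧
      (∀ s < 0, ∀ y, ⟪curl (W s) y, EuclideanSpace.single 2 (1 : ℝ)⟫_ℝ = 0) ∧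
      (∀ s < 0, ∀ y, ⟪fderiv ℝ (W s) y (curl (W s) y), EuclideanSpace.single 2 (1 : ℝ)⟫_ℝ = 0) ∧
      ‖W (-1) 0‖ = Cs ∧
      (∀ t < 0, ∀ x, Real.sqrt (-t) * ‖W t x‖ ≤ ‖W (-1) 0‖) ∧
      ∀ (C' : ℝ) (u' : ℝ → EuclideanSpace ℝ (Fin 3) → EuclideanSpace ℝ (Fin 3)), IsTypeIAncientMild C' u' →
        (∀ s < 0, ∀ y, ⟪curl (u' s) y, EuclideanSpace.single 2 (1 : ℝ)⟫_ℝ = 0) →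
        (∀ s < 0, ∀ y, ⟪fderiv ℝ (u' s) y (curl (u' s) y), EuclideanSpace.single 2 (1 : ℝ)⟫_ℝ = 0) →
        (∃ t < 0, ∃ x, u' t x ≠ 0) → Cs ≤ C' := by
  obtain ⟨C₀, u₀, hu₀, hpol₀, hfro₀, hne₀⟩ := hex
  -- ## the set of admissible constants of nontrivial poloidal frozen elements and its infimum
  set S : Set ℝ := {C' | ∃ u' : ℝ → EuclideanSpace ℝ (Fin 3) → EuclideanSpace ℝ (Fin 3),
    IsTypeIAncientMild C' u' ∧ (∀ s < 0, ∀ y, ⟪curl (u' s) y, EuclideanSpace.single 2 (1 : ℝ)⟫_ℝ = 0) ∧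
      (∀ s < 0, ∀ y, ⟪fderiv ℝ (u' s) y (curl (u' s) y), EuclideanSpace.single 2 (1 : ℝ)⟫_ℝ = 0) ∧
      ∃ t < 0, ∃ x, u' t x ≠ 0} with hS
  have hmem : ∀ {C' : ℝ} {u' : ℝ → EuclideanSpace ℝ (Fin 3) → EuclideanSpace ℝ (Fin 3)},
      IsTypeIAncientMild C' u' → (∀ s < 0, ∀ y, ⟪curl (u' s) y, EuclideanSpace.single 2 (1 : ℝ)⟫_ℝ = 0) →
      (∀ s < 0, ∀ y, ⟪fderiv ℝ (u' s) y (curl (u' s) y), EuclideanSpace.single 2 (1 : ℝ)⟫_ℝ = 0) →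
      (∃ t < 0, ∃ x, u' t x ≠ 0) → C' ∈ S :=
    fun hu' hp hf hne' => ⟨_, hu', hp, hf, hne'⟩
  have hSne : S.Nonempty := ⟨C₀, hmem hu₀ hpol₀ hfro₀ hne₀⟩
  obtain ⟨ε, hε, hsmall⟩ := exists_typeIAncientMild_eq_zero_of_small
  have hSε : ∀ C' ∈ S, ε < C' := by
    rintro C' ⟨u', hu', -, -, t, ht, x, hx⟩
    by_contra hle
    push Not at hle
    exact hx (hsmall C' u' hu' hle t ht x)
  have hSbdd : BddBelow S := ⟨ε, fun C' hC' => (hSε C' hC').le⟩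
  set Cs : ℝ := sInf S with hCs
  have hεCs : ε ≤ Cs := le_csInf hSne fun C' hC' => (hSε C' hC').le
  have hCs0 : 0 < Cs := hε.trans_le hεCs
  have hCsle : ∀ C' ∈ S, Cs ≤ C' := fun C' hC' => csInf_le hSbdd hC'
  -- ## a minimising sequence of nontrivial poloidal frozen elements
  have hδpos : ∀ k : ℕ, (0 : ℝ) < 1 / ((k : ℝ) + 1) := fun k => by positivity
  have hseq : ∀ k : ℕ, ∃ C' ∈ S, C' < Cs + 1 / ((k : ℝ) + 1) := fun k =>
    exists_lt_of_csInf_lt hSne (by linarith [hδpos k])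
  choose Ck hCkS hCklt using hseq
  have hCkge : ∀ k, Cs ≤ Ck k := fun k => hCsle _ (hCkS k)
  have hCkS' : ∀ k, ∃ u' : ℝ → EuclideanSpace ℝ (Fin 3) → EuclideanSpace ℝ (Fin 3),
      IsTypeIAncientMild (Ck k) u' ∧ (∀ s < 0, ∀ y, ⟪curl (u' s) y, EuclideanSpace.single 2 (1 : ℝ)⟫_ℝ = 0) ∧
      (∀ s < 0, ∀ y, ⟪fderiv ℝ (u' s) y (curl (u' s) y), EuclideanSpace.single 2 (1 : ℝ)⟫_ℝ = 0) ∧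
      ∃ t < 0, ∃ x, u' t x ≠ 0 := fun k => hCkS k
  choose uk huk hukpol hukfro hukne using hCkS'
  -- near-maximal points: otherwise `u_k ∈ 𝔓(C⋆ − 1/(k+1))`, against the minimality of `C⋆`
  have hpts : ∀ k : ℕ, ∃ t < 0, ∃ x : EuclideanSpace ℝ (Fin 3),
      Cs - 1 / ((k : ℝ) + 1) < Real.sqrt (-t) * ‖uk k t x‖ := by
    intro k
    by_contra h
    push Not at h
    have hmemk : Cs - 1 / ((k : ℝ) + 1) ∈ S := by
      refine hmem ⟨(huk k).1, (huk k).2.1, (huk k).2.2.1, fun t ht x => ?_⟩ (hukpol k) (hukfro k) (hukne k)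
      rw [le_div_iff₀ (Real.sqrt_pos.2 (neg_pos.2 ht)), mul_comm]
      exact h t ht x
    linarith [hCsle _ hmemk, hδpos k]
  choose tk htk xk hxk using hpts
  -- ## renormalisation to the hot spot `(−1, 0)`
  set vk : ℕ → ℝ → EuclideanSpace ℝ (Fin 3) → EuclideanSpace ℝ (Fin 3) := fun k =>
    nsRescale (Real.sqrt (-tk k)) (fun t x => uk k t (xk k + x)) with hvk_def
  have hck : ∀ k, 0 < Real.sqrt (-tk k) := fun k => Real.sqrt_pos.2 (neg_pos.2 (htk k))
  have hvk : ∀ k, IsTypeIAncientMild (Ck k) (vk k) := fun k =>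
    isTypeIAncientMild_nsRescale (isTypeIAncientMild_translate (huk k) (xk k)) (hck k)
  have hvkpol : ∀ k, ∀ s < 0, ∀ y, ⟪curl (vk k s) y, EuclideanSpace.single 2 (1 : ℝ)⟫_ℝ = 0 := fun k =>
    poloidal_nsRescale (poloidal_translate (hukpol k) (xk k)) (hck k)
  have hvkfro : ∀ k, ∀ s < 0, ∀ y,
      ⟪fderiv ℝ (vk k s) y (curl (vk k s) y), EuclideanSpace.single 2 (1 : ℝ)⟫_ℝ = 0 := fun k =>
    frozen_nsRescale (frozen_translate (hukfro k) (xk k)) (hck k)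
  -- a common constant: `𝔓(C_k) ⊆ 𝔓(C⋆ + 1)`
  have hCk1 : ∀ k : ℕ, Ck k ≤ Cs + 1 := fun k => by
    have h1 : 1 / ((k : ℝ) + 1) ≤ 1 := by
      rw [div_le_one (by positivity)]; linarith [(k.cast_nonneg : (0 : ℝ) ≤ k)]
    linarith [hCklt k]
  have hvk' : ∀ k, IsTypeIAncientMild (Cs + 1) (vk k) := fun k =>
    ⟨(hvk k).1, (hvk k).2.1, (hvk k).2.2.1, fun t ht x =>
      ((hvk k).norm_le ht x).trans (div_le_div_of_nonneg_right (hCk1 k) (Real.sqrt_nonneg _))⟩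
  have hval : ∀ k, ‖vk k (-1) 0‖ = Real.sqrt (-tk k) * ‖uk k (tk k) (xk k)‖ := fun k => by
    simp only [hvk_def]
    rw [nsRescale_apply, smul_zero, add_zero, mul_neg_one, Real.sq_sqrt (neg_nonneg.2 (htk k).le),
      neg_neg, norm_smul, Real.norm_of_nonneg (Real.sqrt_nonneg _)]
  have hlow : ∀ k : ℕ, Cs - 1 / ((k : ℝ) + 1) < ‖vk k (-1) 0‖ := fun k => by
    rw [hval k]; exact hxk k
  have hup : ∀ k, ‖vk k (-1) 0‖ ≤ Ck k := fun k => by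
    have h := (hvk k).norm_le (t := -1) (by norm_num) 0
    rwa [neg_neg, Real.sqrt_one, div_one] at h
  -- ## compactness of the class `𝔓(C⋆ + 1)`, fields AND gradients
  obtain ⟨φ, hφ, W, hW, hpt, hDpt, -, -⟩ := exists_tendsto_of_isTypeIAncientMild_seq (Cs + 1) hvk'
  have hφt : Tendsto φ atTop atTop := hφ.tendsto_atTop
  have hδ : Tendsto (fun j => 1 / (((φ j : ℕ) : ℝ) + 1)) atTop (𝓝 0) :=
    (tendsto_one_div_add_atTop_nhds_zero_nat (𝕜 := ℝ)).comp hφt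
  have hCφ : Tendsto (fun j => Ck (φ j)) atTop (𝓝 Cs) := by
    have hupper : Tendsto (fun j => Cs + 1 / (((φ j : ℕ) : ℝ) + 1)) atTop (𝓝 Cs) := by
      simpa using tendsto_const_nhds.add hδ
    exact tendsto_of_tendsto_of_tendsto_of_le_of_le tendsto_const_nhds hupper
      (fun j => hCkge (φ j)) (fun j => (hCklt (φ j)).le)
  -- ## the limit: Type-I bound with the sharp constant, poloidal, frozen, and the attained value
  have hWI : HasTypeITimeDecay Cs W := fun t ht x =>
    le_of_tendsto_of_tendsto' (hpt t ht x).norm (hCφ.div_const (Real.sqrt (-t)))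
      fun j => (hvk (φ j)).norm_le ht x
  have hWs : IsTypeIAncientMild Cs W := ⟨hW.1, hW.2.1, hW.2.2.1, hWI⟩
  have hWpol : ∀ s < 0, ∀ y, ⟪curl (W s) y, EuclideanSpace.single 2 (1 : ℝ)⟫_ℝ = 0 := fun s hs y =>
    poloidal_of_tendsto (hDpt s hs y) fun j => hvkpol (φ j) s hs y
  have hWfro : ∀ s < 0, ∀ y, ⟪fderiv ℝ (W s) y (curl (W s) y), EuclideanSpace.single 2 (1 : ℝ)⟫_ℝ = 0 :=
    fun s hs y => frozen_of_tendsto (hDpt s hs y) fun j => hvkfro (φ j) s hs y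
  have hnorm : ‖W (-1) 0‖ = Cs := by
    have hlower : Tendsto (fun j => Cs - 1 / (((φ j : ℕ) : ℝ) + 1)) atTop (𝓝 Cs) := by
      simpa using tendsto_const_nhds.sub hδ
    have hsq : Tendsto (fun j => ‖vk (φ j) (-1) 0‖) atTop (𝓝 Cs) :=
      tendsto_of_tendsto_of_tendsto_of_le_of_le hlower hCφ (fun j => (hlow (φ j)).le)
        (fun j => hup (φ j))
    exact tendsto_nhds_unique ((hpt (-1) (by norm_num) 0).norm) hsq
  have hhot : ∀ t < 0, ∀ x, Real.sqrt (-t) * ‖W t x‖ ≤ ‖W (-1) 0‖ := fun t ht x => by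
    rw [hnorm, ← le_div_iff₀' (Real.sqrt_pos.2 (neg_pos.2 ht))]
    exact hWs.norm_le ht x
  -- ## conclusion
  exact ⟨Cs, W, hCs0, hWs, hWpol, hWfro, hnorm, hhot, fun C' u' hu' hp hf hne' => hCsle C' (hmem hu' hp hf hne')⟩

end Summit.NavierStokesRegularity.NavierStokesRegularity.Theorems.PoloidalWindowDoorPoloidalWindowRigidityPoloidalExtremal
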